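import Mathlib.MeasureTheory.Integral.IntervalIntegral.FundThmCalculus
import Mathlib.MeasureTheory.Integral.Bochner.Set
import Mathlib.Analysis.Normed.Ring.Lemmas
import Literature.Analysis.ODE.ComplexSecondOrder
import HarnessLib

/-!
# The outgoing solution of `u″ + φ u = H` on `ℝ` by variation of parameters: the Green
# representation `𝔚·u = u_I ∫_{−∞}^x u_H H + u_H ∫_x^∞ u_I H`, its uniqueness, and the sup bound
# from a two-point kernel bound

Topic `Literature/Analysis/ODE` (namespace `Literature.Analysis.ODE`). Let `φ : ℝ → ℝ` and let
`u_H, u_I : ℝ → ℂ` be two global classical solutions of the homogeneous equation `y″ = −φ y` with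
non-zero (constant) Wronskian `𝔚 = u_H u_I′ − u_H′ u_I`, `u_H` bounded toward `−∞` and "ingoing"
there (`u_H′ + α u_H → 0`), `u_I` bounded toward `+∞` and "outgoing" there (`u_I′ − β u_I → 0`) —
the horizon- and infinity-normalised solutions of a radial wave equation (`α = i(ω − mω₊)`,
`β = iω`). For a continuous integrable source `H` and ANY classical solution `u` of `u″ + φ u = H`
on `ℝ` which is bounded toward both ends and satisfies the same boundary conditions
(`u′ + α u → 0` at `−∞`, `u′ − β u → 0` at `+∞`: DRSR's "outgoing" solutions, arXiv:1402.7034 §5.3,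
Def. 5.1.2 / (eq:b±)), this file proves

* `outgoing_wronskian_mul_eq` — the GREEN REPRESENTATION
  `𝔚 · u(x) = u_I(x) ∫_{(−∞, x]} u_H H + u_H(x) ∫_{(x, ∞)} u_I H` for every `x`. Proof: the right
  side `P` is a classical solution of `P″ + φ P = 𝔚 H` (variation of parameters; the half-line
  integrals exist and are differentiable because `u_H`, `u_I` are bounded toward the respective ends
  and `H ∈ L¹ ∩ C⁰`), so `w = 𝔚 u − P` is a homogeneous solution; its Wronskians with `u_I` and `u_H`
  are constant and equal `𝔚·[(u u_I′ − u′ u_I) − ∫_x^∞ u_I H] → 0` (`x → +∞`) resp.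
  `𝔚·[(u u_H′ − u′ u_H) + ∫_{−∞}^x u_H H] → 0` (`x → −∞`) by the boundary conditions, hence vanish;
  and `w·𝔚 = u_H·W(w, u_I) − u_I·W(w, u_H) = 0` forces `w = 0` (UNIQUENESS of the outgoing solution
  from `𝔚 ≠ 0`, i.e. from mode stability — no flux/sign argument, so superradiant frequencies are
  covered);
* `outgoing_norm_le` — the SUP BOUND: if a two-point kernel bound
  `‖u_H(y)‖‖u_I(x)‖ ≤ K‖𝔚‖` holds for all `y ≤ x` with `x` in an upward-closed set `p`, then
  `‖u(x)‖ ≤ K ∫ ‖H‖` at every `x ∈ p`.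

Supporting lemmas: local bounds from `IsBoundedUnder` + continuity, integrability / derivative /
decay of the half-line integrals `∫_{(−∞,x]} g H`, `∫_{(x,∞)} g H`. Everything is proved; folklore
(Green's function of a Sturm–Liouville operator with separated boundary behaviour, e.g.
Coddington–Levinson Ch. 7 [CoddingtonLevinson1955]; DRSR arXiv:1402.7034 §9.7). NOT here: existence
of the pair `u_H, u_I` or of an outgoing `u` (only uniqueness and the representation are proved),
and any quantitative envelope of `u_H, u_I` (the kernel bound is a hypothesis).

## References
* M. Dafermos, I. Rodnianski, Y. Shlapentokh-Rothman, *Decay for solutions of the wave equation on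
  Kerr exterior spacetimes III*, arXiv:1402.7034 = Ann. of Math. 183 (2016), §5.3, §9.7.
  [DafermosRodnianskiShlapentokhrothman2014]
* Y. Shlapentokh-Rothman, Ann. Henri Poincaré 16 (2015) 289–345 (the inhomogeneous radial ODE
  solved by the Green's function `u_hor u_out/W`). [ShlapentokhRothman2015ModeStability]
* P. Hartman, *Ordinary Differential Equations*, SIAM Classics 38 (2002), Ch. XI §4. [Hartman2002]
-/

noncomputable section

open Set Filter MeasureTheory Topology

namespace Literature.Analysis.ODE

/-! ### Local bounds from bounds toward one end -/

section Bounds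

variable {g : ℝ → ℂ}

/-- A continuous function bounded toward `−∞` is bounded on every half-line `(−∞, b]`.
[folklore] -/
theorem exists_bound_Iic_of_isBoundedUnder (hg : Continuous g)
    (hb : IsBoundedUnder (· ≤ ·) atBot fun y ↦ ‖g y‖) (b : ℝ) : ∃ B, ∀ y ≤ b, ‖g y‖ ≤ B := by
  obtain ⟨B₀, hB₀⟩ := hb.eventually_le
  obtain ⟨a, ha⟩ := eventually_atBot.1 hB₀
  obtain ⟨B₁, hB₁⟩ := isCompact_Icc.exists_bound_of_continuousOn (s := Icc a b) hg.continuousOn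
  refine ⟨max B₀ B₁, fun y hy ↦ ?_⟩
  rcases le_or_gt y a with hya | hya
  · exact (ha y hya).trans (le_max_left _ _)
  · exact (hB₁ y ⟨hya.le, hy⟩).trans (le_max_right _ _)

/-- A continuous function bounded toward `+∞` is bounded on every half-line `[b, ∞)`.
[folklore] -/
theorem exists_bound_Ici_of_isBoundedUnder (hg : Continuous g)
    (hb : IsBoundedUnder (· ≤ ·) atTop fun y ↦ ‖g y‖) (b : ℝ) : ∃ B, ∀ y, b ≤ y → ‖g y‖ ≤ B := by
  obtain ⟨B₀, hB₀⟩ := hb.eventually_le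
  obtain ⟨a, ha⟩ := eventually_atTop.1 hB₀
  obtain ⟨B₁, hB₁⟩ := isCompact_Icc.exists_bound_of_continuousOn (s := Icc b a) hg.continuousOn
  refine ⟨max B₀ B₁, fun y hy ↦ ?_⟩
  rcases le_or_gt a y with hya | hya
  · exact (ha y hya).trans (le_max_left _ _)
  · exact (hB₁ y ⟨hy, hya.le⟩).trans (le_max_right _ _)

end Bounds

/-! ### Half-line integrals `∫_{(−∞,x]} k`, `∫_{(x,∞)} k` of a continuous `k`: derivative and decay -/

section HalfLine

variable {g H k : ℝ → ℂ}

/-- `g·H` is integrable on a measurable set on which `‖g‖ ≤ B`, for `H ∈ L¹`, `g, H` continuous.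
[folklore] -/
theorem integrableOn_mul_of_norm_le (hg : Continuous g) (hH : Continuous H) (hHi : Integrable H)
    {s : Set ℝ} (hs : MeasurableSet s) {B : ℝ} (hB : ∀ y ∈ s, ‖g y‖ ≤ B) :
    IntegrableOn (fun y ↦ g y * H y) s := by
  refine Integrable.mono' (g := fun y ↦ B * ‖H y‖) ((hHi.norm.const_mul B).integrableOn)
    ((hg.mul hH).aestronglyMeasurable) ?_
  refine (ae_restrict_iff' hs).2 (Eventually.of_forall fun y hy ↦ ?_)
  rw [norm_mul]
  exact mul_le_mul_of_nonneg_right (hB y hy) (norm_nonneg _)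

/-- Fundamental theorem of calculus for left half-lines: `d/dx ∫_{(−∞,x]} k = k(x)` for continuous
`k` integrable on every `(−∞, b]`. [folklore] -/
theorem hasDerivAt_integral_Iic_of_integrableOn (hk : Continuous k)
    (hki : ∀ b, IntegrableOn k (Iic b)) (x : ℝ) :
    HasDerivAt (fun z ↦ ∫ y in Iic z, k y) (k x) x := by
  have hev : (fun z ↦ ∫ y in Iic z, k y) =
      fun z ↦ (∫ y in Iic (x - 1), k y) + ∫ y in (x - 1)..z, k y := by
    funext z
    rw [← intervalIntegral.integral_Iic_sub_Iic (hki (x - 1)) (hki z)]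
    ring
  rw [hev]
  exact (intervalIntegral.integral_hasDerivAt_right (hk.intervalIntegrable (x - 1) x)
    (hk.stronglyMeasurableAtFilter volume (𝓝 x)) hk.continuousAt).const_add _

/-- Fundamental theorem of calculus for right half-lines: `d/dx ∫_{(x,∞)} k = −k(x)` for
continuous `k` integrable on every `(b, ∞)`. [folklore] -/
theorem hasDerivAt_integral_Ioi_of_integrableOn (hk : Continuous k)
    (hki : ∀ b, IntegrableOn k (Ioi b)) (x : ℝ) :
    HasDerivAt (fun z ↦ ∫ y in Ioi z, k y) (-k x) x := by
  have hev : (fun z ↦ ∫ y in Ioi z, k y) =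
      fun z ↦ (∫ y in Ioi (x - 1), k y) - ∫ y in (x - 1)..z, k y := by
    funext z
    rw [← intervalIntegral.integral_Ioi_sub_Ioi' (hki (x - 1)) (hki z)]
    ring
  rw [hev]
  exact (intervalIntegral.integral_hasDerivAt_right (hk.intervalIntegrable (x - 1) x)
    (hk.stronglyMeasurableAtFilter volume (𝓝 x)) hk.continuousAt).const_sub _

/-- `∫_{(x,∞)} k → 0` as `x → +∞` (for `k` integrable on every right half-line). [folklore] -/
theorem tendsto_integral_Ioi_atTop_of_integrableOn (hki : ∀ b, IntegrableOn k (Ioi b)) :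
    Tendsto (fun z ↦ ∫ y in Ioi z, k y) atTop (𝓝 0) := by
  have h := tendsto_setIntegral_of_antitone (μ := volume) (f := k) (s := fun z : ℝ ↦ Ioi z)
    (fun _ ↦ measurableSet_Ioi) (fun _ _ hab ↦ Ioi_subset_Ioi hab) ⟨0, hki 0⟩
  have he : (⋂ n : ℝ, Ioi n) = ∅ :=
    eq_empty_of_forall_notMem fun y hy ↦ lt_irrefl y (mem_iInter.1 hy y)
  rw [he, Measure.restrict_empty, integral_zero_measure] at h
  exact h

/-- `∫_{(−∞,x]} k → 0` as `x → −∞` (for `k` integrable on every left half-line). [folklore] -/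
theorem tendsto_integral_Iic_atBot_of_integrableOn (hki : ∀ b, IntegrableOn k (Iic b)) :
    Tendsto (fun z ↦ ∫ y in Iic z, k y) atBot (𝓝 0) := by
  have h := tendsto_setIntegral_of_antitone (μ := volume) (f := k) (s := fun z : ℝ ↦ Iic (-z))
    (fun _ ↦ measurableSet_Iic) (fun _ _ hab ↦ Iic_subset_Iic.2 (neg_le_neg hab)) ⟨0, hki (-0)⟩
  have he : (⋂ n : ℝ, Iic (-n)) = ∅ :=
    eq_empty_of_forall_notMem fun y hy ↦ by
      have h2 : y ≤ -(1 - y) := mem_iInter.1 hy (1 - y)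
      linarith
  rw [he, Measure.restrict_empty, integral_zero_measure] at h
  refine (h.comp tendsto_neg_atBot_atTop).congr fun x ↦ ?_
  show (∫ y in Iic (-(-x)), k y) = ∫ y in Iic x, k y
  rw [neg_neg]

end HalfLine

/-! ### The Green representation of the outgoing solution and its uniqueness -/

section Outgoing

variable {φ : ℝ → ℝ} {uH uH' uI uI' u u₁ u₂ H : ℝ → ℂ} {α β : ℂ}

/-- **Green representation of the outgoing solution (variation of parameters + uniqueness).**
Let `u_H, u_I` be global classical solutions of `y″ = −φ y` on `ℝ` with Wronskian
`𝔚 = u_H(0)u_I′(0) − u_H′(0)u_I(0) ≠ 0`, `u_H` bounded toward `−∞` with `u_H′ + α u_H → 0` there,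
`u_I` bounded toward `+∞` with `u_I′ − β u_I → 0` there. Let `u` be a classical solution of
`u″ + φ u = H` on `ℝ` (`H` continuous and integrable) which is bounded toward both ends and satisfies
`u′ + α u → 0` at `−∞`, `u′ − β u → 0` at `+∞`. Then for every `x`,
`𝔚 · u(x) = u_I(x) ∫_{(−∞,x]} u_H H + u_H(x) ∫_{(x,∞)} u_I H`.
(DRSR arXiv:1402.7034 §9.7: `u = W⁻¹(u_out ∫_{−∞}^{r*} u_hor H + u_hor ∫_{r*}^{∞} u_out H)`; the
uniqueness half is where `𝔚 ≠ 0` — real-axis mode stability — enters.)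
[cite: DafermosRodnianskiShlapentokhrothman2014, §9.7] -/
theorem outgoing_wronskian_mul_eq
    (hH : ∀ x, HasDerivAt uH (uH' x) x ∧ HasDerivAt uH' (-((φ x : ℂ) * uH x)) x)
    (hI : ∀ x, HasDerivAt uI (uI' x) x ∧ HasDerivAt uI' (-((φ x : ℂ) * uI x)) x)
    (hW : uH 0 * uI' 0 - uH' 0 * uI 0 ≠ 0)
    (hHb : IsBoundedUnder (· ≤ ·) atBot fun x ↦ ‖uH x‖)
    (hIb : IsBoundedUnder (· ≤ ·) atTop fun x ↦ ‖uI x‖)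
    (hHo : Tendsto (fun x ↦ uH' x + α * uH x) atBot (𝓝 0))
    (hIo : Tendsto (fun x ↦ uI' x - β * uI x) atTop (𝓝 0))
    (hu : ∀ x, HasDerivAt u (u₁ x) x) (hu₁ : ∀ x, HasDerivAt u₁ (u₂ x) x)
    (hode : ∀ x, u₂ x + (φ x : ℂ) * u x = H x) (hHc : Continuous H) (hHi : Integrable H)
    (hub : IsBoundedUnder (· ≤ ·) atBot fun x ↦ ‖u x‖)
    (hut : IsBoundedUnder (· ≤ ·) atTop fun x ↦ ‖u x‖)
    (huo_bot : Tendsto (fun x ↦ u₁ x + α * u x) atBot (𝓝 0))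
    (huo_top : Tendsto (fun x ↦ u₁ x - β * u x) atTop (𝓝 0)) (x : ℝ) :
    (uH 0 * uI' 0 - uH' 0 * uI 0) * u x =
      uI x * (∫ y in Iic x, uH y * H y) + uH x * (∫ y in Ioi x, uI y * H y) := by
  set W : ℂ := uH 0 * uI' 0 - uH' 0 * uI 0 with hWdef
  -- the two homogeneous solutions as `IsSol2` on `univ`; constancy of Wronskians
  have hsH : IsSol2 (fun t ↦ -(φ t : ℂ)) uH uH' univ :=
    ⟨fun t _ ↦ (hH t).1, fun t _ ↦ by rw [neg_mul]; exact (hH t).2⟩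
  have hsI : IsSol2 (fun t ↦ -(φ t : ℂ)) uI uI' univ :=
    ⟨fun t _ ↦ (hI t).1, fun t _ ↦ by rw [neg_mul]; exact (hI t).2⟩
  have hconst : ∀ {y y' z z' : ℝ → ℂ}, IsSol2 (fun t ↦ -(φ t : ℂ)) y y' univ →
      IsSol2 (fun t ↦ -(φ t : ℂ)) z z' univ → ∀ s t, wronskian y y' z z' s = wronskian y y' z z' t :=
    fun hy hz ↦ is_const_of_deriv_eq_zero
      (fun t ↦ (hy.hasDerivAt_wronskian hz (mem_univ t)).differentiableAt)
      (fun t ↦ (hy.hasDerivAt_wronskian hz (mem_univ t)).deriv)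
  have hWz : ∀ z, uH z * uI' z - uH' z * uI z = W := fun z ↦ hconst hsH hsI z 0
  -- continuity
  have hHc' : Continuous uH := continuous_iff_continuousAt.2 fun t ↦ (hH t).1.continuousAt
  have hIc' : Continuous uI := continuous_iff_continuousAt.2 fun t ↦ (hI t).1.continuousAt
  -- the half-line integrals `F = ∫_{(−∞,·]} u_H H`, `G = ∫_{(·,∞)} u_I H`
  have hiH : ∀ b, IntegrableOn (fun y ↦ uH y * H y) (Iic b) := fun b ↦ by
    obtain ⟨B, hB⟩ := exists_bound_Iic_of_isBoundedUnder hHc' hHb b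
    exact integrableOn_mul_of_norm_le hHc' hHc hHi measurableSet_Iic fun y hy ↦ hB y hy
  have hiI : ∀ b, IntegrableOn (fun y ↦ uI y * H y) (Ioi b) := fun b ↦ by
    obtain ⟨B, hB⟩ := exists_bound_Ici_of_isBoundedUnder hIc' hIb b
    exact integrableOn_mul_of_norm_le hIc' hHc hHi measurableSet_Ioi fun y hy ↦ hB y (le_of_lt hy)
  set F : ℝ → ℂ := fun z ↦ ∫ y in Iic z, uH y * H y with hFdef
  set G : ℝ → ℂ := fun z ↦ ∫ y in Ioi z, uI y * H y with hGdef
  have hF : ∀ z, HasDerivAt F (uH z * H z) z :=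
    hasDerivAt_integral_Iic_of_integrableOn (hHc'.mul hHc) hiH
  have hG : ∀ z, HasDerivAt G (-(uI z * H z)) z :=
    hasDerivAt_integral_Ioi_of_integrableOn (hIc'.mul hHc) hiI
  have hFlim : Tendsto F atBot (𝓝 0) := tendsto_integral_Iic_atBot_of_integrableOn hiH
  have hGlim : Tendsto G atTop (𝓝 0) := tendsto_integral_Ioi_atTop_of_integrableOn hiI
  -- the particular solution `P = u_I F + u_H G` of `P″ + φ P = 𝔚 H`
  set P : ℝ → ℂ := fun z ↦ uI z * F z + uH z * G z with hPdef
  set P' : ℝ → ℂ := fun z ↦ uI' z * F z + uH' z * G z with hP'def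
  have hP : ∀ z, HasDerivAt P (P' z) z := fun z ↦ by
    refine (((hI z).1.mul (hF z)).add ((hH z).1.mul (hG z))).congr_deriv ?_
    simp only [hP'def]
    ring
  have hP' : ∀ z, HasDerivAt P' (-(φ z : ℂ) * P z + W * H z) z := fun z ↦ by
    refine (((hI z).2.mul (hF z)).add ((hH z).2.mul (hG z))).congr_deriv ?_
    simp only [hPdef]
    linear_combination (H z) * hWz z
  -- `w = 𝔚 u − P` is a homogeneous solution
  have hsw : IsSol2 (fun t ↦ -(φ t : ℂ)) (fun z ↦ W * u z - P z) (fun z ↦ W * u₁ z - P' z) univ := by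
    refine ⟨fun z _ ↦ ((hu z).const_mul W).sub (hP z), fun z _ ↦ ?_⟩
    refine (((hu₁ z).const_mul W).sub (hP' z)).congr_deriv ?_
    linear_combination W * hode z
  -- its Wronskians with `u_I`, `u_H`
  have hwI : ∀ z, wronskian (fun z ↦ W * u z - P z) (fun z ↦ W * u₁ z - P' z) uI uI' z =
      W * ((u z * uI' z - u₁ z * uI z) - G z) := fun z ↦ by
    simp only [wronskian, hPdef, hP'def]
    linear_combination (-(G z)) * hWz z
  have hwH : ∀ z, wronskian (fun z ↦ W * u z - P z) (fun z ↦ W * u₁ z - P' z) uH uH' z =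
      W * ((u z * uH' z - u₁ z * uH z) + F z) := fun z ↦ by
    simp only [wronskian, hPdef, hP'def]
    linear_combination (F z) * hWz z
  -- … tend to zero at the respective ends
  have hlimI : Tendsto (fun z ↦ W * ((u z * uI' z - u₁ z * uI z) - G z)) atTop (𝓝 0) := by
    have h1 : Tendsto (fun z ↦ u z * (uI' z - β * uI z)) atTop (𝓝 0) :=
      Filter.isBoundedUnder_le_mul_tendsto_zero hut hIo
    have h2 : Tendsto (fun z ↦ (u₁ z - β * u z) * uI z) atTop (𝓝 0) :=
      huo_top.zero_mul_isBoundedUnder_le hIb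
    have h3 : Tendsto (fun z ↦ W * (u z * (uI' z - β * uI z) - (u₁ z - β * u z) * uI z - G z))
        atTop (𝓝 (W * (0 - 0 - 0))) := ((h1.sub h2).sub hGlim).const_mul W
    rw [sub_zero, sub_zero, mul_zero] at h3
    refine h3.congr fun z ↦ ?_
    ring
  have hlimH : Tendsto (fun z ↦ W * ((u z * uH' z - u₁ z * uH z) + F z)) atBot (𝓝 0) := by
    have h1 : Tendsto (fun z ↦ u z * (uH' z + α * uH z)) atBot (𝓝 0) :=
      Filter.isBoundedUnder_le_mul_tendsto_zero hub hHo
    have h2 : Tendsto (fun z ↦ (u₁ z + α * u z) * uH z) atBot (𝓝 0) :=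
      huo_bot.zero_mul_isBoundedUnder_le hHb
    have h3 : Tendsto (fun z ↦ W * (u z * (uH' z + α * uH z) - (u₁ z + α * u z) * uH z + F z))
        atBot (𝓝 (W * (0 - 0 + 0))) := ((h1.sub h2).add hFlim).const_mul W
    rw [sub_zero, add_zero, mul_zero] at h3
    refine h3.congr fun z ↦ ?_
    ring
  -- … and are constant, hence vanish
  have hWI0 : ∀ z, (u z * uI' z - u₁ z * uI z) - G z = 0 := by
    have hc := hconst hsw hsI
    have ht : Tendsto (wronskian (fun z ↦ W * u z - P z) (fun z ↦ W * u₁ z - P' z) uI uI')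
        atTop (𝓝 0) := hlimI.congr fun z ↦ (hwI z).symm
    intro z
    have hz : Tendsto (fun _ : ℝ ↦ wronskian (fun z ↦ W * u z - P z) (fun z ↦ W * u₁ z - P' z)
        uI uI' z) atTop (𝓝 0) := ht.congr fun t ↦ hc t z
    have h0 := tendsto_nhds_unique tendsto_const_nhds hz
    rw [hwI z] at h0
    exact (mul_eq_zero.1 h0).resolve_left hW
  have hWH0 : ∀ z, (u z * uH' z - u₁ z * uH z) + F z = 0 := by
    have hc := hconst hsw hsH
    have ht : Tendsto (wronskian (fun z ↦ W * u z - P z) (fun z ↦ W * u₁ z - P' z) uH uH')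
        atBot (𝓝 0) := hlimH.congr fun z ↦ (hwH z).symm
    intro z
    have hz : Tendsto (fun _ : ℝ ↦ wronskian (fun z ↦ W * u z - P z) (fun z ↦ W * u₁ z - P' z)
        uH uH' z) atBot (𝓝 0) := ht.congr fun t ↦ hc t z
    have h0 := tendsto_nhds_unique tendsto_const_nhds hz
    rw [hwH z] at h0
    exact (mul_eq_zero.1 h0).resolve_left hW
  -- `w · 𝔚 = u_H · W(w, u_I) − u_I · W(w, u_H) = 0`
  linear_combination (-(uI x)) * hWH0 x + (uH x) * hWI0 x - (u x) * hWz x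

/-- **Sup bound of the outgoing solution from a two-point kernel bound.** In the situation of
`outgoing_wronskian_mul_eq`, suppose `‖u_H(y)‖·‖u_I(x)‖ ≤ K·‖𝔚‖` whenever `y ≤ x` and `p x`, for an
upward-closed predicate `p` (in the application: "the radius of `x` lies beyond the collar"). Then
`‖u(x)‖ ≤ K ∫ ‖H‖` for every `x` with `p x`:
`‖𝔚‖‖u(x)‖ ≤ ‖u_I(x)‖∫_{y ≤ x}‖u_H(y)‖‖H(y)‖ + ‖u_H(x)‖∫_{y > x}‖u_I(y)‖‖H(y)‖ ≤ K‖𝔚‖∫‖H‖`.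
[cite: DafermosRodnianskiShlapentokhrothman2014, §9.7] -/
theorem outgoing_norm_le
    (hH : ∀ x, HasDerivAt uH (uH' x) x ∧ HasDerivAt uH' (-((φ x : ℂ) * uH x)) x)
    (hI : ∀ x, HasDerivAt uI (uI' x) x ∧ HasDerivAt uI' (-((φ x : ℂ) * uI x)) x)
    (hW : uH 0 * uI' 0 - uH' 0 * uI 0 ≠ 0)
    (hHb : IsBoundedUnder (· ≤ ·) atBot fun x ↦ ‖uH x‖)
    (hIb : IsBoundedUnder (· ≤ ·) atTop fun x ↦ ‖uI x‖)
    (hHo : Tendsto (fun x ↦ uH' x + α * uH x) atBot (𝓝 0))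
    (hIo : Tendsto (fun x ↦ uI' x - β * uI x) atTop (𝓝 0))
    (hu : ∀ x, HasDerivAt u (u₁ x) x) (hu₁ : ∀ x, HasDerivAt u₁ (u₂ x) x)
    (hode : ∀ x, u₂ x + (φ x : ℂ) * u x = H x) (hHc : Continuous H) (hHi : Integrable H)
    (hub : IsBoundedUnder (· ≤ ·) atBot fun x ↦ ‖u x‖)
    (hut : IsBoundedUnder (· ≤ ·) atTop fun x ↦ ‖u x‖)
    (huo_bot : Tendsto (fun x ↦ u₁ x + α * u x) atBot (𝓝 0))
    (huo_top : Tendsto (fun x ↦ u₁ x - β * u x) atTop (𝓝 0))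
    {K : ℝ} {p : ℝ → Prop} (hp : ∀ x y, p x → x ≤ y → p y)
    (hK : ∀ y x, y ≤ x → p x → ‖uH y‖ * ‖uI x‖ ≤ K * ‖uH 0 * uI' 0 - uH' 0 * uI 0‖)
    {x : ℝ} (hx : p x) :
    ‖u x‖ ≤ K * ∫ y, ‖H y‖ := by
  have hrep := outgoing_wronskian_mul_eq hH hI hW hHb hIb hHo hIo hu hu₁ hode hHc hHi hub hut
    huo_bot huo_top x
  set W : ℂ := uH 0 * uI' 0 - uH' 0 * uI 0 with hWdef
  have hW0 : 0 < ‖W‖ := norm_pos_iff.2 hW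
  have hHc' : Continuous uH := continuous_iff_continuousAt.2 fun t ↦ (hH t).1.continuousAt
  have hIc' : Continuous uI := continuous_iff_continuousAt.2 fun t ↦ (hI t).1.continuousAt
  obtain ⟨BH, hBH⟩ := exists_bound_Iic_of_isBoundedUnder hHc' hHb x
  obtain ⟨BI, hBI⟩ := exists_bound_Ici_of_isBoundedUnder hIc' hIb x
  have hiH : IntegrableOn (fun y ↦ uH y * H y) (Iic x) :=
    integrableOn_mul_of_norm_le hHc' hHc hHi measurableSet_Iic fun y hy ↦ hBH y hy
  have hiI : IntegrableOn (fun y ↦ uI y * H y) (Ioi x) :=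
    integrableOn_mul_of_norm_le hIc' hHc hHi measurableSet_Ioi fun y hy ↦ hBI y (le_of_lt hy)
  have hnI : IntegrableOn (fun y ↦ ‖H y‖) (Iic x) := hHi.norm.integrableOn
  have hnO : IntegrableOn (fun y ↦ ‖H y‖) (Ioi x) := hHi.norm.integrableOn
  -- the left half-line
  have h1 : ‖uI x‖ * ‖∫ y in Iic x, uH y * H y‖ ≤ K * ‖W‖ * ∫ y in Iic x, ‖H y‖ := by
    calc ‖uI x‖ * ‖∫ y in Iic x, uH y * H y‖
        ≤ ‖uI x‖ * ∫ y in Iic x, ‖uH y * H y‖ :=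
          mul_le_mul_of_nonneg_left (norm_integral_le_integral_norm _) (norm_nonneg _)
      _ = ∫ y in Iic x, ‖uI x‖ * ‖uH y * H y‖ := (integral_const_mul _ _).symm
      _ ≤ ∫ y in Iic x, K * ‖W‖ * ‖H y‖ := by
          refine setIntegral_mono_on (hiH.norm.const_mul _) (hnI.const_mul _) measurableSet_Iic
            fun y hy ↦ ?_
          rw [norm_mul]
          calc ‖uI x‖ * (‖uH y‖ * ‖H y‖) = (‖uH y‖ * ‖uI x‖) * ‖H y‖ := by ring
            _ ≤ (K * ‖W‖) * ‖H y‖ := mul_le_mul_of_nonneg_right (hK y x hy hx) (norm_nonneg _)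
      _ = K * ‖W‖ * ∫ y in Iic x, ‖H y‖ := integral_const_mul _ _
  -- the right half-line
  have h2 : ‖uH x‖ * ‖∫ y in Ioi x, uI y * H y‖ ≤ K * ‖W‖ * ∫ y in Ioi x, ‖H y‖ := by
    calc ‖uH x‖ * ‖∫ y in Ioi x, uI y * H y‖
        ≤ ‖uH x‖ * ∫ y in Ioi x, ‖uI y * H y‖ :=
          mul_le_mul_of_nonneg_left (norm_integral_le_integral_norm _) (norm_nonneg _)
      _ = ∫ y in Ioi x, ‖uH x‖ * ‖uI y * H y‖ := (integral_const_mul _ _).symm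
      _ ≤ ∫ y in Ioi x, K * ‖W‖ * ‖H y‖ := by
          refine setIntegral_mono_on (hiI.norm.const_mul _) (hnO.const_mul _) measurableSet_Ioi
            fun y hy ↦ ?_
          rw [norm_mul]
          calc ‖uH x‖ * (‖uI y‖ * ‖H y‖) = (‖uH x‖ * ‖uI y‖) * ‖H y‖ := by ring
            _ ≤ (K * ‖W‖) * ‖H y‖ :=
                mul_le_mul_of_nonneg_right (hK x y (le_of_lt hy) (hp x y hx (le_of_lt hy)))
                  (norm_nonneg _)
      _ = K * ‖W‖ * ∫ y in Ioi x, ‖H y‖ := integral_const_mul _ _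
  -- assemble
  have hsum : (∫ y in Iic x, ‖H y‖) + ∫ y in Ioi x, ‖H y‖ = ∫ y, ‖H y‖ :=
    intervalIntegral.integral_Iic_add_Ioi hnI hnO
  have key : ‖W‖ * ‖u x‖ ≤ ‖W‖ * (K * ∫ y, ‖H y‖) := by
    calc ‖W‖ * ‖u x‖ = ‖W * u x‖ := (norm_mul _ _).symm
      _ = ‖uI x * (∫ y in Iic x, uH y * H y) + uH x * (∫ y in Ioi x, uI y * H y)‖ := by rw [hrep]
      _ ≤ ‖uI x‖ * ‖∫ y in Iic x, uH y * H y‖ + ‖uH x‖ * ‖∫ y in Ioi x, uI y * H y‖ := by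
          refine (norm_add_le _ _).trans ?_
          rw [norm_mul, norm_mul]
      _ ≤ K * ‖W‖ * (∫ y in Iic x, ‖H y‖) + K * ‖W‖ * ∫ y in Ioi x, ‖H y‖ := add_le_add h1 h2
      _ = ‖W‖ * (K * ∫ y, ‖H y‖) := by rw [← hsum]; ring
  exact le_of_mul_le_mul_left key hW0

end Outgoing

end Literature.Analysis.ODE

end
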